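import Mathlib
import Summits.ValiantsHypothesis.ValiantsHypothesis.Theorems.RigidityForcesSymmetryRankRigidMinimalReprLaplaceFiveStarWedgePoly

/-!
# ValiantsHypothesis / RigidityForcesSymmetry — crux `LaplaceOptimalFive` (stmt-ValiantsHypothesis-24813), crux idea
`young-shadow` (K1) on the star: **LEMMA K, EXIT (II) — PROPORTIONAL MINORS FORCE A BINARY PENCIL**
(memo `NOTE-p4g15-24813-K1-star.md` §14 (c2) «`deg B = 2`», referee note `NOTE-crit3g5-24813-Lemma2prime-elementary.md` §B)

Exit (II) of the denominator trichotomy (✓ `LaplaceFiveStar.denominator_trichotomy`): every `2 × 2` minor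
`M_{ac} = ∂_a Q₁ ∂_c Q₂ − ∂_c Q₁ ∂_a Q₂` of the two quadrics `Q_i = Σ C(U_i a b) X_a X_b` is a scalar multiple `t_{ac} · M₀` of one
non-zero minor `M₀ = M_{a₀c₀}`, i.e. the bivector `U₁y ∧ U₂y = M₀(y) · ω₀` with a CONSTANT `ω₀ = (t_{ac})`.  Then (the paper's
«decomposability of `ω₀`» replaced by the trivial identity `U₁y ∧ (U₁y ∧ U₂y) = 0`, ✓ `wedge_self`): every column of `U₁` and of `U₂`
lies in the plane spanned by the two constant vectors `t(·, c₀)` and `t(·, a₀)` — the pencil `⟨Q₁, Q₂⟩` is BINARY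
(`binary_of_proportional_minors`; combine with ✓ `columns_in_span_of_symmetric_tensor`-style bookkeeping downstream).

Pure algebra; no star hypotheses, no definitions, no `sorry`.  Honest framing: helper toward the Lean price (L2) of the K1-on-the-star
theorem (PAPER, referee PASS; not kernel); `LaplaceOptimalFive` OPEN · CONTESTED 72/120; `VP ≠ VNP` NOT proved.
-/

set_option linter.dupNamespace false

namespace Summit.ValiantsHypothesis.ValiantsHypothesis.Theorems.RigidityForcesSymmetryRankRigidMinimalRepr

namespace LaplaceFiveStar

open Finset MvPolynomial

/-- `p ∧ (p ∧ q) = 0`: `p_x M_{ab} − p_a M_{xb} + p_b M_{xa} = 0` with `M = p ∧ q` (any commutative ring). [folklore] -/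
theorem wedge_self {R : Type*} [CommRing R] {ι : Type*} (p q : ι → R) (x a b : ι) :
    p x * (p a * q b - p b * q a) - p a * (p x * q b - p b * q x) + p b * (p x * q a - p a * q x) = 0 := by
  ring

/-- `q ∧ (p ∧ q) = 0`: `q_x M_{ab} − q_a M_{xb} + q_b M_{xa} = 0` with `M = p ∧ q` (any commutative ring). [folklore] -/
theorem wedge_self' {R : Type*} [CommRing R] {ι : Type*} (p q : ι → R) (x a b : ι) :
    q x * (p a * q b - p b * q a) - q a * (p x * q b - p b * q x) + q b * (p x * q a - p a * q x) = 0 := by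
  ring

/-- If all minors are proportional to `M₀ = M_{a₀c₀} ≠ 0` (`M_{ac} = t_{ac} · M₀`) then `t_{a₀c₀} = 1`. [folklore] -/
theorem proportional_minors_normalised {K : Type*} [Field K] {σ ι : Type*} (p q : ι → MvPolynomial σ K)
    (a₀ c₀ : ι) (t : ι → ι → K) (h0 : p a₀ * q c₀ - p c₀ * q a₀ ≠ 0)
    (hprop : ∀ a c, p a * q c - p c * q a = C (t a c) * (p a₀ * q c₀ - p c₀ * q a₀)) : t a₀ c₀ = 1 := by
  have h := hprop a₀ c₀
  have h1 : (C (1 - t a₀ c₀)) * (p a₀ * q c₀ - p c₀ * q a₀) = 0 := by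
    rw [map_sub, C_1]
    linear_combination h
  rcases mul_eq_zero.mp h1 with h2 | h2
  · have h3 : (1 : K) - t a₀ c₀ = 0 := (C_eq_zero).mp h2
    linear_combination -h3
  · exact absurd h2 h0

/-- Under proportional minors, every row vector `p` (and `q`) is a COMBINATION OF TWO FIXED ROWS with constant coefficients:
`p_x = t_{x c₀} · p_{a₀} − t_{x a₀} · p_{c₀}` (from `p ∧ (p ∧ q) = 0`, cancelling `M₀ ≠ 0`). [folklore] -/
theorem row_eq_of_proportional_minors {K : Type*} [Field K] {σ ι : Type*} (p q : ι → MvPolynomial σ K)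
    (a₀ c₀ : ι) (t : ι → ι → K) (h0 : p a₀ * q c₀ - p c₀ * q a₀ ≠ 0)
    (hprop : ∀ a c, p a * q c - p c * q a = C (t a c) * (p a₀ * q c₀ - p c₀ * q a₀)) (x : ι) :
    p x = C (t x c₀) * p a₀ - C (t x a₀) * p c₀ ∧ q x = C (t x c₀) * q a₀ - C (t x a₀) * q c₀ := by
  have ht : t a₀ c₀ = 1 := proportional_minors_normalised p q a₀ c₀ t h0 hprop
  have e1 := wedge_self p q x a₀ c₀
  have e2 := wedge_self' p q x a₀ c₀
  rw [hprop x c₀, hprop x a₀] at e1 e2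
  constructor
  · refine mul_left_cancel₀ h0 ?_
    linear_combination e1
  · refine mul_left_cancel₀ h0 ?_
    linear_combination e2

/-- **Exit (II) ⟹ binary pencil.**  For two symmetric quadrics `Q_i = Σ C(U_i a b) X_a X_b` whose Jacobian minors
`M_{ac} = ∂_aQ₁ ∂_cQ₂ − ∂_cQ₁ ∂_aQ₂` are all proportional to one non-zero minor `M_{a₀c₀}` (`M_{ac} = C(t a c) · M_{a₀c₀}`), every
column of `U₁` and of `U₂` lies in the span of the two constant vectors `e = t(·, c₀)`, `f = t(·, a₀)`:
`U_i x d = U_i a₀ d · t x c₀ − U_i c₀ d · t x a₀`.  So `⟨Q₁, Q₂⟩ ⊂ Sym²⟨e, f⟩` is a BINARY pencil. [folklore] -/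
theorem binary_of_proportional_minors (U₁ U₂ : Fin 5 → Fin 5 → ℂ)
    (hU1 : ∀ a b : Fin 5, U₁ a b = U₁ b a) (hU2 : ∀ a b : Fin 5, U₂ a b = U₂ b a)
    (Q₁ Q₂ : MvPolynomial (Fin 5) ℂ)
    (hQ₁ : Q₁ = ∑ a : Fin 5, ∑ b : Fin 5, C (U₁ a b) * X a * X b)
    (hQ₂ : Q₂ = ∑ a : Fin 5, ∑ b : Fin 5, C (U₂ a b) * X a * X b)
    (a₀ c₀ : Fin 5) (t : Fin 5 → Fin 5 → ℂ)
    (h0 : pderiv a₀ Q₁ * pderiv c₀ Q₂ - pderiv c₀ Q₁ * pderiv a₀ Q₂ ≠ 0)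
    (hprop : ∀ a c : Fin 5, pderiv a Q₁ * pderiv c Q₂ - pderiv c Q₁ * pderiv a Q₂
      = C (t a c) * (pderiv a₀ Q₁ * pderiv c₀ Q₂ - pderiv c₀ Q₁ * pderiv a₀ Q₂)) (x d : Fin 5) :
    U₁ x d = U₁ a₀ d * t x c₀ - U₁ c₀ d * t x a₀ ∧ U₂ x d = U₂ a₀ d * t x c₀ - U₂ c₀ d * t x a₀ := by
  classical
  obtain ⟨h1, h2⟩ :=
    row_eq_of_proportional_minors (fun a => pderiv a Q₁) (fun a => pderiv a Q₂) a₀ c₀ t h0 hprop x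
  -- evaluate both identities at the basis vector `e_d`
  have ev : ∀ (U : Fin 5 → Fin 5 → ℂ) (hU : ∀ a b : Fin 5, U a b = U b a) (Q : MvPolynomial (Fin 5) ℂ)
      (hQ : Q = ∑ a : Fin 5, ∑ b : Fin 5, C (U a b) * X a * X b) (c : Fin 5),
      MvPolynomial.eval (Pi.single d (1 : ℂ)) (pderiv c Q) = 2 * U c d := by
    intro U hU Q hQ c
    rw [hQ, eval_pderiv_quadric U hU]
    simp [Pi.single_apply]
  constructor
  · have h := congr_arg (MvPolynomial.eval (Pi.single d (1 : ℂ))) h1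
    simp only [map_sub, map_mul, eval_C, ev U₁ hU1 Q₁ hQ₁] at h
    linear_combination h / 2
  · have h := congr_arg (MvPolynomial.eval (Pi.single d (1 : ℂ))) h2
    simp only [map_sub, map_mul, eval_C, ev U₂ hU2 Q₂ hQ₂] at h
    linear_combination h / 2

end LaplaceFiveStar

end Summit.ValiantsHypothesis.ValiantsHypothesis.Theorems.RigidityForcesSymmetryRankRigidMinimalRepr
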